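import Literature.NumberTheory.LFunctions.PsiTailIntegralExplicit
import Literature.NumberTheory.LFunctions.SchoenfeldZeroSumsExplicit
import HarnessLib

/-!
# Unconditional explicit bounds for the tails `∑_{|Im ρ| > T} m(ρ)/|Im ρ|^k` over the zeros of `ζ`

Topic: `Literature/NumberTheory/LFunctions`. THEOREMS (everything proved; no named fact is introduced).
Part of the discharge programme of `Literature.NumberTheory.LFunctions.RosserSchoenfeld1962_eq_3_22`
(Rosser–Schoenfeld 1962, Thm. 6 (3.22)), whose analytic range rests on sums over the non-trivial
zeros `ρ = β + iγ` of `ζ` above a height `T` (Rosser–Schoenfeld 1962, §6, Lemma 6 (8.1)–(8.2);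
Rosser–Schoenfeld 1975, Lemma 7: "`∑ φ(γ)` by Stieltjes integration against `N(y)`").

The tree already has the partial summation of zero sums against the counting function `N(t)` with
the explicit two-sided bounds `N⁻ ≤ N ≤ N⁺` valid for `t ≥ 2516` (`SchoenfeldZeroSums.lean`,
`SchoenfeldZeroSumsExplicit.lean`: `SchoenfeldBound.sum_zerosBetween_le_Gtail`,
`∑_{T < Im ρ ≤ U} m(ρ)/(Im ρ)² ≤ G(T)` for `2516 ≤ T ≤ U`, with
`G(T) = (log(T/2π) + 1)/(2πT) + (72.535 + 13.34 log T)/T² + 1.8625/(3T³)`), and uses it UNDER RH to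
bound `β − ∑_{|Im ρ| ≤ T} m(ρ)/|ρ|²` (`tail_le_explicit`). Here the same finite bound is turned into
bounds for the infinite tails WITHOUT any hypothesis (the tails being suprema of finite two-sided
sums, and the zero set being conjugation-symmetric, `sum_sdiff_zerosUpTo_eq_two_mul`):

* `tailInvImSq T = ∑_{|Im ρ| > T} m(ρ)/(Im ρ)²`, `tailInvImCube T = ∑_{|Im ρ| > T} m(ρ)/|Im ρ|³`
  (absolutely convergent, `summable_tailInvImSq`, `summable_tailInvImCube`, `T ≥ 1`);
* `tailInvImSq_le_of_forall_sum_le` — `tailInvImSq T ≤ 2B` whenever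
  `∑_{T < Im ρ ≤ U} m(ρ)/(Im ρ)² ≤ B` for all `U ≥ T` (`T ≥ 1`);
* **`tailInvImSq_le`** — `∑_{|Im ρ| > T} m(ρ)/(Im ρ)² ≤ 2G(T)` for `T ≥ 2516`;
* **`tailInvImCube_le`** — `∑_{|Im ρ| > T} m(ρ)/|Im ρ|³ ≤ 2G(T)/T` for `T ≥ 2516` (termwise
  `|Im ρ|⁻³ ≤ T⁻¹ (Im ρ)⁻²`);
* **`tailInvNormProd_le`** — the tail `∑_{|Im ρ| > T} m(ρ)/(|ρ||ρ−1|)` of Rosser–Schoenfeld's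
  Lemma 7 (`PsiTailIntegral.tailInvNormProd`, `PsiTailIntegralExplicit.lean`) is `≤ 2G(T)` for
  `T ≥ 2516` (`|ρ|, |ρ − 1| ≥ |Im ρ|`);
* `Gtail_le` — the numerical simplification `G(T) ≤ 0.17 log T/T` for `T ≥ 2516`.

## References

* J. B. Rosser, L. Schoenfeld, Illinois J. Math. 6 (1962), 64–94, §6 and Lemma 6. [RosserSchoenfeld1962]
* J. B. Rosser, L. Schoenfeld, Math. Comp. 29 (1975), 243–269, Lemma 7. [RosserSchoenfeld1975]
* L. Schoenfeld, Math. Comp. 30 (1976), 337–360, Lemma 9. [Schoenfeld1976]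
-/

noncomputable section

open Complex Filter Set MeasureTheory Topology
open scoped Real ComplexConjugate

namespace Literature.NumberTheory.LFunctions

namespace ZetaZeroTails

open NicolasJExplicit SchoenfeldBound PsiTailIntegral

/-! ### The two tails and their convergence -/

/-- `tailInvImSq T = ∑_{|Im ρ| > T} m(ρ)/(Im ρ)²` (over the non-trivial zeros, with multiplicity).
[cite: RosserSchoenfeld1975, Lemma 7] -/
def tailInvImSq (T : ℝ) : ℝ :=
  ∑' ρ : Zeros, if ρ ∈ zerosUpTo T then 0 else (riemannZetaZeroOrder (ρ : ℂ) : ℝ) / (ρ : ℂ).im ^ 2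

/-- `tailInvImCube T = ∑_{|Im ρ| > T} m(ρ)/|Im ρ|³`. [cite: RosserSchoenfeld1975, Lemma 7] -/
def tailInvImCube (T : ℝ) : ℝ :=
  ∑' ρ : Zeros, if ρ ∈ zerosUpTo T then 0 else (riemannZetaZeroOrder (ρ : ℂ) : ℝ) / |(ρ : ℂ).im| ^ 3

/-- For a zero above height `T ≥ 1`: `T < |Im ρ|`, `‖ρ‖ ≤ 2|Im ρ|`, `‖ρ − 1‖ ≤ 2|Im ρ|`. [folklore] -/
theorem aux_of_not_mem {T : ℝ} (hT : 1 ≤ T) {ρ : Zeros} (hρ : ρ ∉ zerosUpTo T) :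
    T < |(ρ : ℂ).im| ∧ ‖(ρ : ℂ)‖ ≤ 2 * |(ρ : ℂ).im| ∧ ‖(ρ : ℂ) - 1‖ ≤ 2 * |(ρ : ℂ).im| := by
  have h1 : T < |(ρ : ℂ).im| := lt_of_not_ge fun h ↦ hρ (mem_zerosUpTo.2 h)
  have hre0 := re_pos ρ.2
  have hre1 := re_lt_one ρ.2
  refine ⟨h1, ?_, ?_⟩
  · have h := Complex.norm_le_abs_re_add_abs_im (ρ : ℂ)
    rw [abs_of_pos hre0] at h
    linarith
  · have h := Complex.norm_le_abs_re_add_abs_im ((ρ : ℂ) - 1)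
    have h2 : |((ρ : ℂ) - 1).re| ≤ 1 := by
      rw [sub_re, one_re, abs_le]; constructor <;> linarith
    have h3 : ((ρ : ℂ) - 1).im = (ρ : ℂ).im := by simp
    rw [h3] at h
    linarith

/-- Termwise: `m(ρ)/(Im ρ)² ≤ 4 m(ρ)/(|ρ||ρ−1|)` above height `T ≥ 1`. [folklore] -/
theorem term_invImSq_le {T : ℝ} (hT : 1 ≤ T) (ρ : Zeros) :
    (if ρ ∈ zerosUpTo T then (0 : ℝ) else (riemannZetaZeroOrder (ρ : ℂ) : ℝ) / (ρ : ℂ).im ^ 2) ≤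
      4 * ((riemannZetaZeroOrder (ρ : ℂ) : ℝ) / (‖(ρ : ℂ)‖ * ‖(ρ : ℂ) - 1‖)) := by
  have hm := zeroOrder_nonneg' ρ
  have hd : 0 ≤ (riemannZetaZeroOrder (ρ : ℂ) : ℝ) / (‖(ρ : ℂ)‖ * ‖(ρ : ℂ) - 1‖) :=
    div_nonneg hm (mul_nonneg (norm_nonneg _) (norm_nonneg _))
  split_ifs with hρ
  · linarith
  · obtain ⟨h1, h2, h3⟩ := aux_of_not_mem hT hρ
    have hγ : 0 < |(ρ : ℂ).im| := by linarith
    have hn0 : 0 < ‖(ρ : ℂ)‖ := norm_pos ρ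
    have hn1 : 0 < ‖(ρ : ℂ) - 1‖ := norm_pos_iff.2 (sub_one_ne_zero ρ)
    rw [← sq_abs, show 4 * ((riemannZetaZeroOrder (ρ : ℂ) : ℝ) / (‖(ρ : ℂ)‖ * ‖(ρ : ℂ) - 1‖)) =
      (riemannZetaZeroOrder (ρ : ℂ) : ℝ) * (4 / (‖(ρ : ℂ)‖ * ‖(ρ : ℂ) - 1‖)) by ring, div_eq_mul_inv]
    refine mul_le_mul_of_nonneg_left ?_ hm
    rw [inv_eq_one_div, div_le_div_iff₀ (by positivity) (by positivity)]
    nlinarith [mul_le_mul h2 h3 hn1.le (by positivity)]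

/-- `∑_{|Im ρ| > T} m(ρ)/(Im ρ)²` converges (`T ≥ 1`). [folklore] -/
theorem summable_tailInvImSq {T : ℝ} (hT : 1 ≤ T) :
    Summable fun ρ : Zeros ↦ if ρ ∈ zerosUpTo T then (0 : ℝ) else
      (riemannZetaZeroOrder (ρ : ℂ) : ℝ) / (ρ : ℂ).im ^ 2 := by
  refine Summable.of_nonneg_of_le (fun ρ ↦ ?_) (term_invImSq_le hT)
    (summable_zeroOrder_div_norm_mul_norm_sub_one.mul_left 4)
  split_ifs
  · exact le_rfl
  · exact div_nonneg (zeroOrder_nonneg' ρ) (sq_nonneg _)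

/-- Termwise: `m(ρ)/|Im ρ|³ ≤ T⁻¹ · m(ρ)/(Im ρ)²` above height `T ≥ 1`. [folklore] -/
theorem term_invImCube_le {T : ℝ} (hT : 1 ≤ T) (ρ : Zeros) :
    (if ρ ∈ zerosUpTo T then (0 : ℝ) else (riemannZetaZeroOrder (ρ : ℂ) : ℝ) / |(ρ : ℂ).im| ^ 3) ≤
      T⁻¹ * (if ρ ∈ zerosUpTo T then (0 : ℝ) else (riemannZetaZeroOrder (ρ : ℂ) : ℝ) / (ρ : ℂ).im ^ 2) := by
  have hm := zeroOrder_nonneg' ρ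
  split_ifs with hρ
  · simp
  · obtain ⟨h1, -, -⟩ := aux_of_not_mem hT hρ
    have hT0 : 0 < T := by linarith
    have hγ : 0 < |(ρ : ℂ).im| := by linarith
    rw [← sq_abs, show T⁻¹ * ((riemannZetaZeroOrder (ρ : ℂ) : ℝ) / |(ρ : ℂ).im| ^ 2) =
      (riemannZetaZeroOrder (ρ : ℂ) : ℝ) * (1 / (T * |(ρ : ℂ).im| ^ 2)) by field_simp, div_eq_mul_inv,
      inv_eq_one_div]
    refine mul_le_mul_of_nonneg_left ?_ hm
    rw [div_le_div_iff₀ (by positivity) (by positivity)]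
    nlinarith [mul_le_mul_of_nonneg_right h1.le (sq_nonneg |(ρ : ℂ).im|)]

/-- `∑_{|Im ρ| > T} m(ρ)/|Im ρ|³` converges (`T ≥ 1`). [folklore] -/
theorem summable_tailInvImCube {T : ℝ} (hT : 1 ≤ T) :
    Summable fun ρ : Zeros ↦ if ρ ∈ zerosUpTo T then (0 : ℝ) else
      (riemannZetaZeroOrder (ρ : ℂ) : ℝ) / |(ρ : ℂ).im| ^ 3 := by
  refine Summable.of_nonneg_of_le (fun ρ ↦ ?_) (term_invImCube_le hT) ((summable_tailInvImSq hT).mul_left _)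
  split_ifs
  · exact le_rfl
  · exact div_nonneg (zeroOrder_nonneg' ρ) (pow_nonneg (abs_nonneg _) 3)

/-- `tailInvImSq T ≥ 0`. [folklore] -/
theorem tailInvImSq_nonneg (T : ℝ) : 0 ≤ tailInvImSq T := by
  refine tsum_nonneg fun ρ ↦ ?_
  split_ifs
  · exact le_rfl
  · exact div_nonneg (zeroOrder_nonneg' ρ) (sq_nonneg _)

/-- `tailInvImCube T ≥ 0`. [folklore] -/
theorem tailInvImCube_nonneg (T : ℝ) : 0 ≤ tailInvImCube T := by
  refine tsum_nonneg fun ρ ↦ ?_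
  split_ifs
  · exact le_rfl
  · exact div_nonneg (zeroOrder_nonneg' ρ) (pow_nonneg (abs_nonneg _) 3)

/-- **`∑_{|Im ρ| > T} m(ρ)/|Im ρ|³ ≤ T⁻¹ ∑_{|Im ρ| > T} m(ρ)/(Im ρ)²`** (`T ≥ 1`). [folklore] -/
theorem tailInvImCube_le_inv_mul {T : ℝ} (hT : 1 ≤ T) : tailInvImCube T ≤ T⁻¹ * tailInvImSq T := by
  rw [tailInvImCube, tailInvImSq, ← tsum_mul_left]
  exact (summable_tailInvImCube hT).tsum_le_tsum (term_invImCube_le hT) ((summable_tailInvImSq hT).mul_left _)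

/-- **`∑_{|Im ρ| > T} m(ρ)/(|ρ||ρ−1|) ≤ ∑_{|Im ρ| > T} m(ρ)/(Im ρ)²`** (`T ≥ 1`; `|ρ|, |ρ−1| ≥ |Im ρ|`).
[folklore] -/
theorem tailInvNormProd_le_tailInvImSq {T : ℝ} (hT : 1 ≤ T) : tailInvNormProd T ≤ tailInvImSq T := by
  refine (summable_tailInvNormProd T).tsum_le_tsum (fun ρ ↦ ?_) (summable_tailInvImSq hT)
  split_ifs with hρ
  · exact le_rfl
  · obtain ⟨h1, -, -⟩ := aux_of_not_mem hT hρ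
    have hγ : 0 < |(ρ : ℂ).im| := by linarith
    have ha : |(ρ : ℂ).im| ≤ ‖(ρ : ℂ)‖ := Complex.abs_im_le_norm _
    have hb : |(ρ : ℂ).im| ≤ ‖(ρ : ℂ) - 1‖ := abs_im_le_norm_sub_one ρ
    rw [← sq_abs]
    refine div_le_div_of_nonneg_left (zeroOrder_nonneg' ρ) (by positivity) ?_
    nlinarith [mul_le_mul ha hb hγ.le (norm_nonneg _)]

/-! ### The tail as a supremum of finite one-sided sums -/

/-- **From uniform bounds between heights to the tail**: for `T ≥ 1`, if
`∑_{T < Im ρ ≤ U} m(ρ)/(Im ρ)² ≤ B` for every `U ≥ T`, then `∑_{|Im ρ| > T} m(ρ)/(Im ρ)² ≤ 2B` (every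
finite partial sum of the tail lies below some height `U`, and the two-sided sum over
`T < |Im ρ| ≤ U` is twice the one-sided one). [cite: Schoenfeld1976, Lemma 9] -/
theorem tailInvImSq_le_of_forall_sum_le {T B : ℝ} (hT : 1 ≤ T)
    (h : ∀ U, T ≤ U → ∑ ρ ∈ zerosBetween T U, (riemannZetaZeroOrder ρ : ℝ) * (ρ.im ^ 2)⁻¹ ≤ B) :
    tailInvImSq T ≤ 2 * B := by
  classical
  have h0 : 0 ≤ T := by linarith
  refine hasSum_le_of_sum_le (summable_tailInvImSq hT).hasSum fun s ↦ ?_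
  -- a height above every zero of `s`
  set U : ℝ := T + ∑ ρ ∈ s, |(ρ : ℂ).im| with hU
  have hTU : T ≤ U := by
    rw [hU]; linarith [Finset.sum_nonneg (fun ρ (_ : ρ ∈ s) ↦ abs_nonneg ((ρ : ℂ).im))]
  have hle : ∀ ρ ∈ s, |(ρ : ℂ).im| ≤ U := fun ρ hρ ↦ by
    rw [hU]
    have := Finset.single_le_sum (fun ρ' (_ : ρ' ∈ s) ↦ abs_nonneg ((ρ' : ℂ).im)) hρ
    linarith
  have h1 : ∑ ρ ∈ s, (if ρ ∈ zerosUpTo T then 0 else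
      (riemannZetaZeroOrder (ρ : ℂ) : ℝ) / (ρ : ℂ).im ^ 2) ≤
      ∑ ρ ∈ zerosUpTo U \ zerosUpTo T, (riemannZetaZeroOrder (ρ : ℂ) : ℝ) / (ρ : ℂ).im ^ 2 := by
    rw [← Finset.sum_filter_add_sum_filter_not s (fun ρ ↦ ρ ∈ zerosUpTo T)]
    rw [Finset.sum_congr rfl (fun ρ hρ ↦ if_pos (Finset.mem_filter.1 hρ).2), Finset.sum_const_zero,
      zero_add, Finset.sum_congr rfl (fun ρ hρ ↦ if_neg (Finset.mem_filter.1 hρ).2)]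
    refine Finset.sum_le_sum_of_subset_of_nonneg (fun ρ hρ ↦ ?_) fun ρ _ _ ↦
      div_nonneg (zeroOrder_nonneg' ρ) (sq_nonneg _)
    rw [Finset.mem_filter] at hρ
    exact Finset.mem_sdiff.2 ⟨mem_zerosUpTo.2 (hle ρ hρ.1), hρ.2⟩
  have h2 := sum_sdiff_zerosUpTo_eq_two_mul h0 (T₂ := U)
    (g := fun z ↦ (riemannZetaZeroOrder z : ℝ) / z.im ^ 2)
    (fun z ↦ by simp only [riemannZetaZeroOrder_conj_holds z, Complex.conj_im, neg_sq])
  have h3 : ∑ ρ ∈ zerosBetween T U, (riemannZetaZeroOrder ρ : ℝ) / ρ.im ^ 2 =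
      ∑ ρ ∈ zerosBetween T U, (riemannZetaZeroOrder ρ : ℝ) * (ρ.im ^ 2)⁻¹ :=
    Finset.sum_congr rfl fun ρ _ ↦ div_eq_mul_inv _ _
  have h4 := h U hTU
  rw [h3] at h2
  linarith

/-! ### Explicit bounds for `T ≥ 2516` -/

/-- **`∑_{|Im ρ| > T} m(ρ)/(Im ρ)² ≤ 2G(T)` for `T ≥ 2516`** (unconditionally).
[cite: Schoenfeld1976, Lemma 9] -/
theorem tailInvImSq_le {T : ℝ} (hT : 2516 ≤ T) : tailInvImSq T ≤ 2 * Gtail T :=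
  tailInvImSq_le_of_forall_sum_le (by linarith) fun _ hU ↦ sum_zerosBetween_le_Gtail hT hU

/-- **`∑_{|Im ρ| > T} m(ρ)/(|ρ||ρ−1|) ≤ 2G(T)` for `T ≥ 2516`**: the tail of Rosser–Schoenfeld's `K`
(Lemma 7 of Rosser–Schoenfeld 1962, `PsiTailIntegral.rsK_le_of_inStripUpTo`).
[cite: RosserSchoenfeld1962, Lemma 6 (8.2)] -/
theorem tailInvNormProd_le {T : ℝ} (hT : 2516 ≤ T) : tailInvNormProd T ≤ 2 * Gtail T :=
  (tailInvNormProd_le_tailInvImSq (by linarith)).trans (tailInvImSq_le hT)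

/-- **`∑_{|Im ρ| > T} m(ρ)/|Im ρ|³ ≤ 2G(T)/T` for `T ≥ 2516`.** [cite: RosserSchoenfeld1975, Lemma 7] -/
theorem tailInvImCube_le {T : ℝ} (hT : 2516 ≤ T) : tailInvImCube T ≤ 2 * Gtail T / T := by
  have hT0 : 0 < T := by linarith
  have h1 := tailInvImCube_le_inv_mul (T := T) (by linarith)
  have h2 := tailInvImSq_le hT
  rw [div_eq_inv_mul]
  exact h1.trans (mul_le_mul_of_nonneg_left h2 (inv_nonneg.2 hT0.le))

/-! ### A numerical simplification of `G(T)` -/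

/-- `log 2516 ≥ 7.83` (`e^{7.83} < 2516`). [folklore] -/
theorem log_2516_ge : (7.83 : ℝ) ≤ Real.log 2516 := by
  rw [Real.le_log_iff_exp_le (by norm_num)]
  have h1 : Real.exp 7.83 = Real.exp 1 ^ 7 * Real.exp 0.83 := by
    rw [← Real.exp_nat_mul, ← Real.exp_add]; norm_num
  have h2 : Real.exp 0.83 ≤ 2.2934 := by
    have := Real.exp_bound (x := 0.83) (by norm_num) (n := 12) (by norm_num)
    -- crude route: `exp 0.83 ≤ ∑_{k<12} 0.83^k/k! + error`
    simp only [Finset.sum_range_succ, Finset.sum_range_zero, Nat.factorial] at this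
    norm_num at this
    have habs := abs_sub_le_iff.1 this
    linarith [habs.1]
  have h3 : Real.exp 1 ^ 7 ≤ (2.7182818286 : ℝ) ^ 7 :=
    pow_le_pow_left₀ (Real.exp_pos 1).le Real.exp_one_lt_d9.le 7
  rw [h1]
  have h4 : (0 : ℝ) ≤ Real.exp 0.83 := (Real.exp_pos _).le
  nlinarith

/-- **`G(T) ≤ 0.17 log T/T` for `T ≥ 2516`** (`(log(T/2π)+1)/(2π) ≤ 0.1592 log T − 0.1333`,
`(72.535 + 13.34 log T)/T ≤ 22.61 log T/2516`, `1.8625/(3T²) ≤ 10⁻⁷`). [folklore] -/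
theorem Gtail_le {T : ℝ} (hT : 2516 ≤ T) : Gtail T ≤ 0.17 * Real.log T / T := by
  have hT0 : 0 < T := by linarith
  have hπ := Real.pi_gt_d6
  have hπ' := Real.pi_lt_d6
  have hlogT : 7.83 ≤ Real.log T := log_2516_ge.trans (Real.log_le_log (by norm_num) hT)
  have hlog2π : 1.8378 ≤ Real.log (2 * π) := by
    rw [Real.le_log_iff_exp_le (by positivity)]
    have h1 : Real.exp 1.8378 = Real.exp 1 * Real.exp 0.8378 := by
      rw [← Real.exp_add]; norm_num
    have h2 : Real.exp 0.8378 ≤ 2.31135 := by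
      have := Real.exp_bound (x := 0.8378) (by norm_num) (n := 12) (by norm_num)
      simp only [Finset.sum_range_succ, Finset.sum_range_zero, Nat.factorial] at this
      norm_num at this
      have habs := abs_sub_le_iff.1 this
      linarith [habs.1]
    rw [h1]
    have := Real.exp_one_lt_d9
    have h4 : (0 : ℝ) ≤ Real.exp 0.8378 := (Real.exp_pos _).le
    nlinarith
  unfold Gtail
  rw [Real.log_div hT0.ne' (by positivity)]
  -- write everything over `T`: multiply through by `T > 0`
  rw [show (0.17 : ℝ) * Real.log T / T = (0.17 * Real.log T) * T⁻¹ by ring]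
  have hT1 : T⁻¹ = T⁻¹ := rfl
  have hinv2 : (T ^ 2)⁻¹ = T⁻¹ * T⁻¹ := by rw [sq, mul_inv]
  have hinv3 : (T ^ 3)⁻¹ = T⁻¹ * T⁻¹ * T⁻¹ := by rw [pow_succ, sq, mul_inv, mul_inv]
  rw [hinv2, hinv3]
  have hi0 : 0 < T⁻¹ := inv_pos.2 hT0
  have hi1 : T⁻¹ ≤ 1 / 2516 := by rw [inv_eq_one_div]; exact div_le_div_of_nonneg_left (by norm_num) (by norm_num) hT
  -- it suffices to compare the coefficients of `T⁻¹`
  have key : (Real.log T - Real.log (2 * π) + 1) / (2 * π) +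
      (2 * 34.6 + 6.67 / 2 + 2 * 6.67 * Real.log T) * T⁻¹ + 5 * 0.3725 / 3 * (T⁻¹ * T⁻¹) ≤
      0.17 * Real.log T := by
    have h1 : (Real.log T - Real.log (2 * π) + 1) / (2 * π) ≤ 0.1592 * Real.log T - 0.1333 := by
      rw [div_le_iff₀ (by positivity)]
      nlinarith
    have h2 : (2 * 34.6 + 6.67 / 2 + 2 * 6.67 * Real.log T) * T⁻¹ ≤ 0.009 * Real.log T := by
      have : (2 * 34.6 + 6.67 / 2 + 2 * 6.67 * Real.log T) ≤ 22.61 * Real.log T := by nlinarith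
      calc (2 * 34.6 + 6.67 / 2 + 2 * 6.67 * Real.log T) * T⁻¹ ≤ 22.61 * Real.log T * (1 / 2516) := by
            exact mul_le_mul this hi1 hi0.le (by nlinarith)
        _ ≤ 0.009 * Real.log T := by nlinarith
    have h3 : 5 * 0.3725 / 3 * (T⁻¹ * T⁻¹) ≤ 0.0001 := by
      have : T⁻¹ * T⁻¹ ≤ (1 / 2516) * (1 / 2516) := mul_le_mul hi1 hi1 hi0.le (by norm_num)
      nlinarith
    nlinarith
  calc (Real.log T - Real.log (2 * π) + 1) / (2 * π) * T⁻¹ +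
        (2 * 34.6 + 6.67 / 2 + 2 * 6.67 * Real.log T) * (T⁻¹ * T⁻¹) +
        5 * 0.3725 / 3 * (T⁻¹ * T⁻¹ * T⁻¹)
      = ((Real.log T - Real.log (2 * π) + 1) / (2 * π) +
          (2 * 34.6 + 6.67 / 2 + 2 * 6.67 * Real.log T) * T⁻¹ + 5 * 0.3725 / 3 * (T⁻¹ * T⁻¹)) * T⁻¹ := by
        ring
    _ ≤ (0.17 * Real.log T) * T⁻¹ := mul_le_mul_of_nonneg_right key hi0.le

end ZetaZeroTails

end Literature.NumberTheory.LFunctions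

end
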